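import Summits.QuantumFields.BalabanUV.Beta.FP.PerfectPropagatorRemainderSymbol
import Summits.QuantumFields.BalabanUV.Beta.FP.PerfectSymbolDeriv

/-!
# `BalabanUV.Beta.FP.PerfectRemainderSliceLocal` — road «FP» for binder row D1, leaf H2-P, row H2-P-KER-ASM v1 (owner re-assignment l.21097, R-FP-21 (B3)):
# TODAY's ORDER-3 SLICE CHAIN OF THE REMAINDER SYMBOL `B = PinfSym − |p̂|⁻²𝟙` AT THE CONTINUUM WEIGHTS `Re W_∞`, MADE UNCONDITIONAL — links on the open
# interval, graded letters `‖∂ₜᵏB‖ ≤ 3ᵏ·Krem∕‖p‖ᵏ` (k ≤ 3) on the punctured zone, `2π`-periodic endpoint values, measurable top slice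

HONEST DEPENDENCY (page 1, mandatory): continuum YM on T⁴ ⇐ BetaPertH ∧ nine spine estimates (0/9 proved); BetaPertH ⇐ (D1) ∧ (D4) ∧ CAP+tail;
G-an2-4 gates asym, D1 and NE2/3/4.  HONEST FRAMING (cell contract, verbatim): «discharging `BetaPertH` makes Bałaban's UV stability UNCONDITIONAL —
a real constructive-QFT result; it is NOT the continuum limit and NOT the Clay problem.»  THIS MODULE DISCHARGES NOTHING of the wall.  WHY IT EXISTS: the order-3
chain of record `FP/RemainderSymbolSlice` (p235721) ∕ its instance `FP/PerfectPropagatorRemainderSymbol` (p236670) display the weight regularity in the GLOBAL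
currency `hwC : ∀ p μ ν, ContDiff ℝ 3 (t ↦ Re W_∞(update p i t))` of R1 (`FP/MaxwellSymbolDeriv`), which the Lean object `W166Inf` does not satisfy (unremoved
removable singularities at real `−2πl`, `l ≠ 0` — gan24-p3-g16's correction, CLAIMS l.20785) and which H2-P-REG R2 as landed (`FP/PerfectSymbolDeriv`, LOCAL on
`U = (−(π+δ₁₆₆), π+δ₁₆₆)`, p236916) therefore cannot discharge.  Here the SAME chain (the data defs `feynSl`, `excSl`, `remSl0…3` of p235721, untouched) is
re-derived at `w := Re W_∞` from R2's LOCAL theorems BY NAME (`hasDerivAt_perfect_feyn_chain`, `hasDerivAt_perfect_excess_chain`, `graded_perfect_feyn_entry`,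
`graded_perfect_excess_entry`, constants `KAP`, `KRP`), with the invertibility ∕ coercive-inverse rows from `PerfectPropagatorRemainderSymbol.hdet_wInf` ∕
`hinv_wInf` — so every hypothesis below is a slice position (`t`, `q ∈ BZ d`, `q ≠ 0`), nothing else.  One explicit real constant `Krem` ([our object]); no
`def … : Prop`; nothing cited; 0 sorry; 0 wall binders; NOT D1, NOT BetaPertH, NOT continuum, NOT Clay.

ABSOLUTE RULE (cell charter, verbatim): «No internally-minted statement may enter as a cited fact. Every hypothesis is either kernel-proved in this package or a
verbatim quotation of a PUBLISHED theorem with page reference. The manuscript(s) under audit are NOT citable for their own disputed steps — they are the thing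
under adjudication; programme-internal (2001/route/tribunal) claims are never citable.»

WHAT (lattice dimension `d + 1`; base point `s`, direction `i`, transverse part `q := i.removeNth s ∈ BZ d`, `q ≠ 0`; `δ := delta166 (d+1)`,
`U := Ioo (−(π+δ)) (π+δ)`, `V := Ioo (−π−δ) (−π+δ)` the left side neighbourhood; `wInf μ ν s = Re W_∞(μ,ν; s)`):
* §1 [folklore] base-point invariance `remSl0∕1∕2∕3_update` (the curves depend on `s` only through the line — announced in p235721's docstring, proved here);
  `feynMat_congr_offDiag` ∕ `maxwellMat_congr_offDiag` (diagonal weights never enter); `d1Sym_update_add_two_pi`, `fD_add_two_pi`.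
* §2 [our object] `2π`-PERIODICITY NEAR THE LEFT SIDE of the matrix slices (`feyn_slice_add_two_pi`, `excess_slice_add_two_pi`, from
  `PerfectSymbol166RealLine.sliceW_add_two_pi` — identity theorem — for the off-diagonal weights), hence invertibility of the Feynman slice on ALL of `U`
  (`hdet_wInf_U`: outside `[−π,π]` by periodicity back into the zone).
* §3 [our object] THE LINKS ON `U`: `hasDerivAt_feynSl_wInf` ∕ `hasDerivAt_excSl_wInf` (R2's chains read on p235721's curves, base point moved into the zone by
  `feynSl_update`), **`hasDerivAt_remSl0∕1∕2_wInf_U`** — `(remSl_k)′ = remSl_{k+1}` at every `t ∈ U`; continuity of `remSl0∕1∕2` on `U`.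
* §4–§6 (periodic endpoint values `remSl_k (−π) = remSl_k π`, measurability of the top slice, the UNCONDITIONAL graded letters
  `‖remSl_k wInf s i α β t‖ ≤ 3ᵏ·Krem d∕‖p‖ᵏ`) are the sequel `FP/PerfectRemainderSliceLocalLetters` (split by the 400-line rule).
Consumed by `FP/PerfectPropagatorKernel` (H2-P-KER-ASM v1) through `FP/PuncturedCoordDerivMajorant`.
Provenance: G-an2-4 swarm leaf prover 05, gen 35 (prover-b2b-balaban-gan24-formalise-leaf-05-g35-0), cross-lane on road FP (INTENT CLAIMS l.21819), 2026-08-20.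
-/

noncomputable section

namespace Summit.QuantumFields.BalabanUV.Beta.FP.PerfectRemainderSliceLocal

open Matrix Filter Finset Set MeasureTheory
open scoped Matrix.Norms.Operator BigOperators Topology
open Literature.MathematicalPhysics.QuantumFieldTheory.Balaban1983to89
open B4Strip (ofRealVec)
open B4ContourShift (BZ ofRealVec_insertNth)
open B5Prop11Fiber (d1Sym)
open Literature.Probability.LatticeModels (dispersion)
open Summit.QuantumFields.BalabanUV.Beta.FP.PerfectSymbol166 (W166Inf)
open Summit.QuantumFields.BalabanUV.Beta.FP.PerfectSymbol166StripReg (delta166 delta166_pos)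
open Summit.QuantumFields.BalabanUV.Beta.FP.PerfectSymbol166RealLine (sliceW sideNbhd sliceW_add_two_pi delta166_le_pi)
open B5Symbol166Strip (kappa166 kappa166_pos)
open Summit.QuantumFields.BalabanUV.Beta.FP.PerfectPropagatorSymbol (feynMat maxwellMat)
open Summit.QuantumFields.BalabanUV.Beta.FP.MatrixInvDeriv (hasDerivAt_of_entries)
open Summit.QuantumFields.BalabanUV.Beta.FP.DispersionSliceChain (fD fD1 fD2 fD3 fD_eq hasDerivAt_fD hasDerivAt_fD1 hasDerivAt_fD2 fD_pos norm_sq_le_fD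
  abs_fD1_le abs_fD2_le abs_fD3_le)
open Summit.QuantumFields.BalabanUV.Beta.FP.RemainderSymbolChain (bSl0 bSl1 bSl2 bSl3 uSl0 zSl0 aSum cSum hasDerivAt_bSl0 hasDerivAt_bSl1 hasDerivAt_bSl2
  norm_bSl_le)
open Summit.QuantumFields.BalabanUV.Beta.FP.SliceReciprocalChain (rc0)
open Summit.QuantumFields.BalabanUV.Beta.FP.RemainderSymbolSlice (feynSl excSl remSl0 remSl1 remSl2 remSl3 feynSl_zero excSl_zero feynSl_update excSl_update
  removeNth_update update_eq_insertNth slicePt_facts)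
open Summit.QuantumFields.BalabanUV.Beta.FP.PerfectPropagatorRemainderSymbol (wInf hdet_wInf hinv_wInf)
open Summit.QuantumFields.BalabanUV.Beta.FP.PerfectSymbolDeriv (KAP KRP hasDerivAt_perfect_feyn_chain hasDerivAt_perfect_excess_chain graded_perfect_feyn_entry
  graded_perfect_excess_entry)
open Summit.QuantumFields.BalabanUV.Beta.GAN24.InverseRate (norm_le_card_mul)

variable {d : ℕ}

/-! ## §1 Base-point invariance; diagonal weights never enter; periodic letters -/

section Basic

variable (w : Fin (d + 1) → Fin (d + 1) → (Fin (d + 1) → ℝ) → ℝ) (s : Fin (d + 1) → ℝ) (i : Fin (d + 1))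

/-- [folklore] `remSl0 w (update s i t₀) i = remSl0 w s i` (the curve depends on `s` only through the line). -/
theorem remSl0_update (t₀ : ℝ) : remSl0 w (Function.update s i t₀) i = remSl0 w s i := by
  funext α β u; simp only [remSl0, feynSl_update, excSl_update, removeNth_update]

/-- [folklore] `remSl1 w (update s i t₀) i = remSl1 w s i`. -/
theorem remSl1_update (t₀ : ℝ) : remSl1 w (Function.update s i t₀) i = remSl1 w s i := by
  funext α β u; simp only [remSl1, feynSl_update, excSl_update, removeNth_update]

/-- [folklore] `remSl2 w (update s i t₀) i = remSl2 w s i`. -/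
theorem remSl2_update (t₀ : ℝ) : remSl2 w (Function.update s i t₀) i = remSl2 w s i := by
  funext α β u; simp only [remSl2, feynSl_update, excSl_update, removeNth_update]

/-- [folklore] `remSl3 w (update s i t₀) i = remSl3 w s i`. -/
theorem remSl3_update (t₀ : ℝ) : remSl3 w (Function.update s i t₀) i = remSl3 w s i := by
  funext α β u; simp only [remSl3, feynSl_update, excSl_update, removeNth_update]

end Basic

/-- [folklore] the weighted Maxwell matrix does not see the diagonal weights. -/
theorem maxwellMat_congr_offDiag {W W' : Fin (d + 1) → Fin (d + 1) → ℝ} (h : ∀ μ ν, μ ≠ ν → W μ ν = W' μ ν) (ph : Fin (d + 1) → ℂ) :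
    maxwellMat W ph = maxwellMat W' ph := by
  ext α β
  unfold maxwellMat
  refine Finset.sum_congr rfl fun μ _ => Finset.sum_congr rfl fun ν _ => ?_
  by_cases hμν : μ = ν
  · simp [hμν]
  · simp [hμν, h μ ν hμν]

/-- [folklore] … nor does its Feynman completion. -/
theorem feynMat_congr_offDiag {W W' : Fin (d + 1) → Fin (d + 1) → ℝ} (h : ∀ μ ν, μ ≠ ν → W μ ν = W' μ ν) (ph : Fin (d + 1) → ℂ) :
    feynMat W ph = feynMat W' ph := by
  ext α β
  unfold feynMat
  rw [maxwellMat_congr_offDiag h ph]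

/-- [folklore] the momentum factors `p̂ = (e^{is_a} − 1)_a` are `2π`-periodic in the slice parameter. -/
theorem d1Sym_update_add_two_pi (s : Fin (d + 1) → ℝ) (i : Fin (d + 1)) (t : ℝ) :
    d1Sym (Function.update s i (t + 2 * Real.pi)) = d1Sym (Function.update s i t) := by
  funext a
  unfold d1Sym
  by_cases ha : a = i
  · subst ha
    simp only [Function.update_self]
    have : (((t + 2 * Real.pi : ℝ)) : ℂ) * Complex.I = (t : ℂ) * Complex.I + 2 * Real.pi * Complex.I := by push_cast; ring
    rw [this, Complex.exp_add, Complex.exp_two_pi_mul_I, mul_one]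
  · simp only [Function.update_of_ne ha]

/-- [folklore] the dispersion factor `fD q i = 2ε` along the slice is `2π`-periodic. -/
theorem fD_add_two_pi (q : Fin d → ℝ) (i : Fin (d + 1)) (t : ℝ) : fD q i (t + 2 * Real.pi) = fD q i t := by
  rw [fD_eq, fD_eq, Real.cos_add_two_pi]

/-- [folklore] the weight slice read through `sliceW`: `Re W_∞(μ,ν; update s i t) = Re (sliceW μ ν i (removeNth i s) t)`. -/
theorem wInf_update_eq_sliceW (μ ν : Fin (d + 1)) (s : Fin (d + 1) → ℝ) (i : Fin (d + 1)) (t : ℝ) :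
    wInf μ ν (Function.update s i t) = (sliceW μ ν i (i.removeNth s) (t : ℂ)).re := by
  simp only [wInf, sliceW, update_eq_insertNth s i t, ofRealVec_insertNth]

/-- [folklore] a real parameter in the left side interval is a point of the side neighbourhood. -/
theorem ofReal_mem_sideNbhd {t : ℝ} (ht : t ∈ Ioo (-Real.pi - delta166 (d + 1)) (-Real.pi + delta166 (d + 1))) :
    (t : ℂ) ∈ sideNbhd (kappa166 (d + 1)) (delta166 (d + 1)) := by
  have hκ := kappa166_pos (d + 1); have hδ := delta166_pos (d + 1)
  refine ⟨?_, ?_, ?_⟩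
  · rw [Complex.ofReal_re]; exact ht.1
  · rw [Complex.ofReal_re]; exact ht.2
  · rw [Complex.ofReal_im, abs_zero]; linarith

/-! ## §2 `2π`-periodicity of the matrix slices near the left side; invertibility on all of `U` -/

section Periodic

variable {s : Fin (d + 1) → ℝ} {i : Fin (d + 1)} (hq : i.removeNth s ∈ BZ d)

include hq in
/-- [our object] off the diagonal the weights are `2π`-periodic near the left side: `Re W_∞(update s i (t + 2π)) = Re W_∞(update s i t)` for `t ∈ V`. -/
theorem wInf_update_add_two_pi {μ ν : Fin (d + 1)} (hμν : μ ≠ ν) {t : ℝ}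
    (ht : t ∈ Ioo (-Real.pi - delta166 (d + 1)) (-Real.pi + delta166 (d + 1))) :
    wInf μ ν (Function.update s i (t + 2 * Real.pi)) = wInf μ ν (Function.update s i t) := by
  rw [wInf_update_eq_sliceW, wInf_update_eq_sliceW]
  have h := sliceW_add_two_pi hμν i hq (ofReal_mem_sideNbhd ht)
  push_cast
  rw [h]

include hq in
/-- [our object] **THE FEYNMAN SLICE IS `2π`-PERIODIC NEAR THE LEFT SIDE**: for `t ∈ V`,
`feynMat (Re W_∞(update s i (t+2π))) (p̂(update s i (t+2π))) = feynMat (Re W_∞(update s i t)) (p̂(update s i t))`. -/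
theorem feyn_slice_add_two_pi {t : ℝ} (ht : t ∈ Ioo (-Real.pi - delta166 (d + 1)) (-Real.pi + delta166 (d + 1))) :
    feynMat (fun μ ν => wInf μ ν (Function.update s i (t + 2 * Real.pi))) (d1Sym (Function.update s i (t + 2 * Real.pi)))
      = feynMat (fun μ ν => wInf μ ν (Function.update s i t)) (d1Sym (Function.update s i t)) := by
  rw [d1Sym_update_add_two_pi]
  exact feynMat_congr_offDiag (fun μ ν hμν => wInf_update_add_two_pi hq hμν ht) _

include hq in
/-- [our object] … and so is the excess slice `maxwellMat (Re W_∞ − 1) (p̂)`. -/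
theorem excess_slice_add_two_pi {t : ℝ} (ht : t ∈ Ioo (-Real.pi - delta166 (d + 1)) (-Real.pi + delta166 (d + 1))) :
    maxwellMat (fun μ ν => wInf μ ν (Function.update s i (t + 2 * Real.pi)) - 1) (d1Sym (Function.update s i (t + 2 * Real.pi)))
      = maxwellMat (fun μ ν => wInf μ ν (Function.update s i t) - 1) (d1Sym (Function.update s i t)) := by
  rw [d1Sym_update_add_two_pi]
  exact maxwellMat_congr_offDiag (fun μ ν hμν => by rw [wInf_update_add_two_pi hq hμν ht]) _

include hq in
/-- [our object] **INVERTIBILITY OF THE FEYNMAN SLICE ON ALL OF `U`** (`q ≠ 0`): inside `[−π,π]` by `hdet_wInf`, outside by periodicity back into the zone. -/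
theorem hdet_wInf_U (hq0 : i.removeNth s ≠ 0) {t : ℝ}
    (ht : t ∈ Ioo (-(Real.pi + delta166 (d + 1))) (Real.pi + delta166 (d + 1))) :
    IsUnit (feynMat (fun μ ν => wInf μ ν (Function.update s i t)) (d1Sym (Function.update s i t))).det := by
  have hδ := delta166_pos (d + 1); have hδπ := delta166_le_pi (d + 1)
  -- the zone case, at an arbitrary parameter
  have zone : ∀ u ∈ Icc (-Real.pi) Real.pi,
      IsUnit (feynMat (fun μ ν => wInf μ ν (Function.update s i u)) (d1Sym (Function.update s i u))).det := by
    intro u hu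
    obtain ⟨hmem, hne, -, -⟩ := slicePt_facts hu hq hq0 (s := s) (i := i)
    exact hdet_wInf _ hmem hne
  by_cases h1 : t < -Real.pi
  · -- left of the zone: `t ∈ V`, move to `t + 2π ∈ [−π, π]`
    have htV : t ∈ Ioo (-Real.pi - delta166 (d + 1)) (-Real.pi + delta166 (d + 1)) := ⟨by linarith [ht.1], by linarith⟩
    rw [← feyn_slice_add_two_pi hq htV]
    exact zone _ ⟨by linarith [ht.1], by linarith⟩
  · by_cases h2 : Real.pi < t
    · -- right of the zone: `t − 2π ∈ V ∩ [−π, π]`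
      have htV : t - 2 * Real.pi ∈ Ioo (-Real.pi - delta166 (d + 1)) (-Real.pi + delta166 (d + 1)) :=
        ⟨by linarith, by linarith [ht.2]⟩
      have e : t = (t - 2 * Real.pi) + 2 * Real.pi := by ring
      rw [e, feyn_slice_add_two_pi hq htV]
      exact zone _ ⟨by linarith, by linarith [ht.2]⟩
    · push Not at h1 h2
      exact zone t ⟨h1, h2⟩

end Periodic

/-! ## §3 The links on the open interval `U` -/

section Links

variable {s : Fin (d + 1) → ℝ} {i : Fin (d + 1)} (hq : i.removeNth s ∈ BZ d)

include hq in
/-- [folklore] the base point moved into the zone: `update s i 0 ∈ BZ (d+1)`. -/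
theorem update_zero_mem_BZ : Function.update s i 0 ∈ BZ (d + 1) := by
  rw [update_eq_insertNth]
  exact DispersionSliceChain.insertNth_mem_BZ i ⟨by linarith [Real.pi_pos], Real.pi_pos.le⟩ hq

include hq in
/-- [our object] **THE FEYNMAN CURVE LINKS AT `Re W_∞` ON `U`**: `(feynSl j)′ = feynSl (j+1)` at `t ∈ U`, `j < 3` (R2's `hasDerivAt_perfect_feyn_chain` entrywise). -/
theorem hasDerivAt_feynSl_wInf {j : ℕ} (hj : j < 3) {t : ℝ}
    (ht : t ∈ Ioo (-(Real.pi + delta166 (d + 1))) (Real.pi + delta166 (d + 1))) :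
    HasDerivAt (feynSl (wInf (d := d)) s i j) (feynSl (wInf (d := d)) s i (j + 1) t) t := by
  have hp := update_zero_mem_BZ hq
  rw [← feynSl_update (wInf (d := d)) s i 0]
  refine hasDerivAt_of_entries fun γ β => ?_
  have h := hasDerivAt_perfect_feyn_chain hp i γ β hj ht
  simpa [feynSl] using h

include hq in
/-- [our object] **THE EXCESS CURVE LINKS AT `Re W_∞` ON `U`** (entrywise): `(excSl j · γ β)′ = excSl (j+1) t γ β`, `j < 3`. -/
theorem hasDerivAt_excSl_wInf {j : ℕ} (hj : j < 3) {t : ℝ}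
    (ht : t ∈ Ioo (-(Real.pi + delta166 (d + 1))) (Real.pi + delta166 (d + 1))) (γ β : Fin (d + 1)) :
    HasDerivAt (fun v => excSl (wInf (d := d)) s i j v γ β) (excSl (wInf (d := d)) s i (j + 1) t γ β) t := by
  have hp := update_zero_mem_BZ hq
  rw [← excSl_update (wInf (d := d)) s i 0]
  have h := hasDerivAt_perfect_excess_chain hp i γ β hj ht
  simpa [excSl] using h

variable (hq0 : i.removeNth s ≠ 0)

include hq hq0 in
/-- [our object] **`(remSl0)′ = remSl1` AT EVERY `t ∈ U`**, unconditionally at `Re W_∞`. -/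
theorem hasDerivAt_remSl0_wInf_U {t : ℝ} (ht : t ∈ Ioo (-(Real.pi + delta166 (d + 1))) (Real.pi + delta166 (d + 1))) (α β : Fin (d + 1)) :
    HasDerivAt (remSl0 (wInf (d := d)) s i α β) (remSl1 (wInf (d := d)) s i α β t) t := by
  have hdet : IsUnit (feynSl (wInf (d := d)) s i 0 t).det := by rw [feynSl_zero]; exact hdet_wInf_U hq hq0 ht
  unfold remSl0 remSl1
  exact hasDerivAt_bSl0 (hasDerivAt_feynSl_wInf hq (by norm_num) ht) hdet
    (fun γ β => hasDerivAt_excSl_wInf hq (by norm_num) ht γ β) (hasDerivAt_fD _ i t) (fD_pos hq hq0 i t).ne' α β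

include hq hq0 in
/-- [our object] **`(remSl1)′ = remSl2` AT EVERY `t ∈ U`.** -/
theorem hasDerivAt_remSl1_wInf_U {t : ℝ} (ht : t ∈ Ioo (-(Real.pi + delta166 (d + 1))) (Real.pi + delta166 (d + 1))) (α β : Fin (d + 1)) :
    HasDerivAt (remSl1 (wInf (d := d)) s i α β) (remSl2 (wInf (d := d)) s i α β t) t := by
  have hdet : IsUnit (feynSl (wInf (d := d)) s i 0 t).det := by rw [feynSl_zero]; exact hdet_wInf_U hq hq0 ht
  unfold remSl1 remSl2
  exact hasDerivAt_bSl1 (hasDerivAt_feynSl_wInf hq (by norm_num) ht) (hasDerivAt_feynSl_wInf hq (by norm_num) ht) hdet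
    (fun γ β => hasDerivAt_excSl_wInf hq (by norm_num) ht γ β) (fun γ β => hasDerivAt_excSl_wInf hq (by norm_num) ht γ β)
    (hasDerivAt_fD _ i t) (hasDerivAt_fD1 t) (fD_pos hq hq0 i t).ne' α β

include hq hq0 in
/-- [our object] **`(remSl2)′ = remSl3` AT EVERY `t ∈ U`.** -/
theorem hasDerivAt_remSl2_wInf_U {t : ℝ} (ht : t ∈ Ioo (-(Real.pi + delta166 (d + 1))) (Real.pi + delta166 (d + 1))) (α β : Fin (d + 1)) :
    HasDerivAt (remSl2 (wInf (d := d)) s i α β) (remSl3 (wInf (d := d)) s i α β t) t := by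
  have hdet : IsUnit (feynSl (wInf (d := d)) s i 0 t).det := by rw [feynSl_zero]; exact hdet_wInf_U hq hq0 ht
  unfold remSl2 remSl3
  exact hasDerivAt_bSl2 (hasDerivAt_feynSl_wInf hq (by norm_num) ht) (hasDerivAt_feynSl_wInf hq (by norm_num) ht)
    (hasDerivAt_feynSl_wInf hq (by norm_num) ht) hdet
    (fun γ β => hasDerivAt_excSl_wInf hq (by norm_num) ht γ β) (fun γ β => hasDerivAt_excSl_wInf hq (by norm_num) ht γ β)
    (fun γ β => hasDerivAt_excSl_wInf hq (by norm_num) ht γ β)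
    (hasDerivAt_fD _ i t) (hasDerivAt_fD1 t) (hasDerivAt_fD2 t) (fD_pos hq hq0 i t).ne' α β

/-- [folklore] `[−π, π] ⊆ U`. -/
theorem Icc_subset_U : Icc (-Real.pi) Real.pi ⊆ Ioo (-(Real.pi + delta166 (d + 1))) (Real.pi + delta166 (d + 1)) := by
  have hδ := delta166_pos (d + 1)
  intro t ht; exact ⟨by linarith [ht.1], by linarith [ht.2]⟩

/-- [folklore] the left side interval `V ⊆ U`. -/
theorem V_subset_U : Ioo (-Real.pi - delta166 (d + 1)) (-Real.pi + delta166 (d + 1))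
    ⊆ Ioo (-(Real.pi + delta166 (d + 1))) (Real.pi + delta166 (d + 1)) := by
  have hδ := delta166_pos (d + 1); have hδπ := delta166_le_pi (d + 1)
  intro t ht; exact ⟨by linarith [ht.1], by linarith [ht.2, Real.pi_pos]⟩

/-- [folklore] `V + 2π ⊆ U`. -/
theorem V_add_two_pi_mem_U {t : ℝ} (ht : t ∈ Ioo (-Real.pi - delta166 (d + 1)) (-Real.pi + delta166 (d + 1))) :
    t + 2 * Real.pi ∈ Ioo (-(Real.pi + delta166 (d + 1))) (Real.pi + delta166 (d + 1)) := by
  have hδ := delta166_pos (d + 1)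
  exact ⟨by linarith [ht.1, Real.pi_pos], by linarith [ht.2]⟩

include hq hq0 in
/-- [our object] `remSl0`, `remSl1`, `remSl2` are continuous on `U` (differentiable there). -/
theorem continuousOn_remSl_wInf_U (α β : Fin (d + 1)) :
    ContinuousOn (remSl0 (wInf (d := d)) s i α β) (Ioo (-(Real.pi + delta166 (d + 1))) (Real.pi + delta166 (d + 1))) ∧
      ContinuousOn (remSl1 (wInf (d := d)) s i α β) (Ioo (-(Real.pi + delta166 (d + 1))) (Real.pi + delta166 (d + 1))) ∧
      ContinuousOn (remSl2 (wInf (d := d)) s i α β) (Ioo (-(Real.pi + delta166 (d + 1))) (Real.pi + delta166 (d + 1))) :=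
  ⟨fun _ ht => (hasDerivAt_remSl0_wInf_U hq hq0 ht α β).continuousAt.continuousWithinAt,
    fun _ ht => (hasDerivAt_remSl1_wInf_U hq hq0 ht α β).continuousAt.continuousWithinAt,
    fun _ ht => (hasDerivAt_remSl2_wInf_U hq hq0 ht α β).continuousAt.continuousWithinAt⟩

end Links

end Summit.QuantumFields.BalabanUV.Beta.FP.PerfectRemainderSliceLocal

end
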